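import Summits.ResolutionOfSingularities.ResolutionOfSingularities.Theorems.HilbertSamuelEliminationSigmaMaxModificationsCorridor3WMono
import HarnessLib

/-!
# [OURS · L1 W4.2] REGISTERED STUB `stub_Wmono` OF SKELETON `w_ladder` v6 (bec1bc9e9d6383b2, stmt-ResolutionOfSingularities-19249)
# CLOSED BY NAME AND SIGNATURE — crux chain w42, LEAD PROVER res-L1-w42-lead-1 gen 3

OURS (cell res-hironaka, slot W4.2); NOT a statement of H. Hironaka's manuscript [Hironaka2017]; AI proving, weaker than expert
review. The registered signature (CHAIN v3.9-1 (R1), plan-1 05:34:29Z / REGISTERED 05:36:55Z) is W-mono BEHIND ITS ONE PRINTED BINDER,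
CJS Thm. 3.10 (4) (`Literature.AlgebraicGeometry.Resolution.CossartJannsenSaito2020_thm_3_10_4`, p499783); the proof is the helper
`Helpers.stub_Wmono_of_thm_3_10_4` (p500936, `…Corridor3WMono.lean`: degenerate value by the regular-point argument, generic value by
the s42 state invariant + off-centre isomorphism + the fact at the closed near point). `--supports stmt-ResolutionOfSingularities-19249`.

## References

* V. Cossart, U. Jannsen, S. Saito, LNM 2270 (2020), Thm. 3.10 (4), Lemma 5.34 (3). [CossartJannsenSaito2020]
-/

noncomputable section

set_option linter.dupNamespace false -- mandated namespace of this single-conjunct summit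

open Literature.AlgebraicGeometry.Resolution
open Summit.ResolutionOfSingularities.ResolutionOfSingularities.Theorems.SigmaMaxModificationsCorridor3.Helpers

namespace Summit.ResolutionOfSingularities.ResolutionOfSingularities.Cruxes.SigmaMaxModificationsCorridor3.WLadder

/-- **REGISTERED STUB `stub_Wmono` (skeleton `w_ladder` v6, bec1bc9e9d6383b2) — W-MONO behind its printed binder CJS Thm. 3.10 (4):
along a canonical near step from a stage reached from a maximal origin at level `3`, `ē` does not increase.** [OURS · L1 W4.2] replaces
the role of CJS Thm. 3.10 (4) + Lemma 5.34 (3) in the line `w_ladder`; NOT a statement of the manuscript.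
[cite: CossartJannsenSaito2020, Thm. 3.10 (4), Lemma 5.34 (3)] -/
theorem stub_Wmono : CossartJannsenSaito2020_thm_3_10_4.{0} →
    ∀ p : ℕ, p.Prime → ClosedOriginGeomDirDimNonincrease.{0} p 3 :=
  fun h => stub_Wmono_of_thm_3_10_4 h

end Summit.ResolutionOfSingularities.ResolutionOfSingularities.Cruxes.SigmaMaxModificationsCorridor3.WLadder

end
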